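import Literature.MathematicalPhysics.QuantumFieldTheory.Balaban1983to89.B8Ineq192MultiLevelTorus
import Literature.MathematicalPhysics.QuantumFieldTheory.Balaban1983to89.B6Prop22DerivMultiLevelTorus
import Literature.MathematicalPhysics.QuantumFieldTheory.Balaban1983to89.B6Prop22LapMultiLevelTorus

/-!
# `Balaban1983to89.B8Ineq192MultiLevelTorusP22` — T. Bałaban, *Spaces of regular gauge field configurations on a lattice and gauge
# fixing conditions*, Commun. Math. Phys. **99** (1985) 75–102 [Balaban1985RegularSpaces], p. 92 «|Rf| ≦ B′₀|f|» and the kernel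
# of (1.91), (1.92) and the p. 93 Δ-entry AT U₀ = 1 ON THE `k`-LEVEL TORUS FAMILY — THE [B6] PROP. 2.2 TORUS ENTRIES 1, 2, 6
# DISCHARGED BY NAME (p21's `prop22_first_multiLevelTorus` T4, `prop22_second_multiLevelTorus` T6, `prop22_sixth_multiLevelTorus` T5):
# the corollaries of `B8Ineq192MultiLevelTorus` §3/§5 in which only the inverse `(Q′G′²Q′*)⁻¹` still enters by its printed (2.87)-bound

statement-level skeleton of published theorems with citation tags; proofs where landed; nothing here is a claim about the Yang–Mills mass gap

CITATION HEADER (lean-in-tree rule).  Cell `lit-balaban`, unit `lit-balaban-r05` gen 54 (B8 owner; successor step of the module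
docstring of `B8Ineq192MultiLevelTorus`, p342575).  WHAT IS REPRODUCED = rows **B8.Claim@92** («|Rf| ≦ B′₀|f|», p. 92) and the
kernel half of **B8.Eq1.91** on print's carrier `T_η` at the flat background, NOW WITH THE GENUINE FIRST-ENTRY MAJORANT OF
`G′ = gmlT`: `B8Ineq192MultiLevelTorus.rProjMLT_sup_bound` and `.hKer_decay_T` take the [B6] Prop. 2.2 first entry as an
argument; p21's `B6Prop22MultiLevelTorus.prop22_first_multiLevelTorus` (T4 of the torus carrier, p342287) PROVES it for every
member of the family under print's regime (`M_h ≥ 3`, «M large» `L·M_h ≥ M₀`, `R ≥ 2L`, `RM ≥ N₀ + 1`, torus size `P_μ ≥ 4`, weights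
in the windows with `a_{i+1} = aNext ℓ a_i c_i`), so here those hypotheses replace the majorant and the only remaining argument is
the inverse `G = (Q′G′²Q′*)⁻¹` with its two printed Prop.-2.3 properties (a torus Prop. 2.3 is not in the tree).  The (1.92)
members with `∇_μ = dT N₀ μ` (p21's periodic forward difference `S_{e_μ} − 1`) and the p. 93 Δ-entry with `−Δ_T = perLapT N₀` are
discharged the same way by the second and sixth torus entries (p21's `B6Prop22DerivMultiLevelTorus.prop22_second_multiLevelTorus`,
T6, and `B6Prop22LapMultiLevelTorus.prop22_sixth_multiLevelTorus`, T5 p342798), merged to the smallest rate and the largest constant /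
thresholds: `ineq192_multiLevelTorus_P22` = THE MAIN THEOREM OF `B8Ineq192MultiLevelTorus` WITH ALL THREE PROP.-2.2 HYPOTHESES
DISCHARGED.  Theorems only; every input BY NAME; 0 sorry.

WHAT IS PRINTED (verbatim).  p. 92 [PDF 18]: *"from Theorems 3.1, 3.2 of [4] it follows that |Rf| ≦ B′₀|f|"*, *"where
(H′X)(x) = Σ_{y′∈𝔅_k}(L^{j′}η)^d H′(x, y′)X(y′), and B′₀ is an absolute constant (depending on d and L only)."*, (1.92) *"|(H′X)(x)|,
|(∇H′X)(x)| ≦ B′₀[1, (Lʲη)⁻¹]|X| for x ∈ Ω_j"*, p. 93 [PDF 19] l. 1–4 (the Δ-entry consumed in (1.99)); [B6] CMP **96**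
[Balaban1984PropagatorsII] Prop. 2.2 (2.67) p. 234 (first entry «|G′λ| ≦ O(1)(Lʲη)²e^{−½δ₀d}|λ|», second entry «|∇^η_xG′λ| ≦
O(1)Lʲηe^{−½δ₀d}|λ|», sixth entry «|Δ^ηG′λ| ≦ O(1)e^{−½δ₀d}|λ|»), Prop. 2.3 (2.87) p. 238, p. 224 «we admit the case when some domains
Ω_j are equal to T_η».

HONEST SCOPE.  Model instance at U₀ = 1 on p21's torus family (levels `1 … k`, `Ω₁ = T_η`, `m² = 0`, lattice units, `P_μ ≥ 4` for
the charts of T4–T6); `(Q′G′²Q′*)⁻¹` is the argument `G` (conditional on an inhabitant with the (2.87)-bound); constants existential;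
rows B8.Eq1.91 / B8.Eq1.92 / B8.Claim@92 heads NOT changed.  NOT summit progress, NOT continuum, NOT Clay.
-/

namespace Literature.MathematicalPhysics.QuantumFieldTheory.Balaban1983to89.B8Ineq192MultiLevelTorusP22

open Matrix
open B4Reflection242 (boxDom)
open B6MultiLevelBoxOperator
open B6MultiLevelTorusOperator
open B6Geom246MultiLevelBox
open B6Geom246MultiLevelTorus
open B6Ineq268MultiLevelBox
open B6RandomWalk (HasMajorant hasMajorant_mono)
open B6Ineq243TwoLevelBox (aNext)
open B6Prop23Chain (mat)
open B6Prop22MultiLevelTorus (prop22_first_multiLevelTorus)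
open B6Prop22DerivMultiLevelTorus (dT prop22_second_multiLevelTorus)
open B6Prop22LapMultiLevelTorus (prop22_sixth_multiLevelTorus)
open B8Ineq192MultiLevelTorus

noncomputable section

variable {d : ℕ}

/-- **«|Rf| ≦ B′₀|f|» (p. 92) AT U₀ = 1 ON THE `k`-LEVEL TORUS FAMILY WITH THE GENUINE FIRST PROP.-2.2 ENTRY** — only the inverse
`(Q′G′²Q′*)⁻¹` still enters by its (2.87)-bound: for every `C₁, δ₁ > 0` there are `B′₀, M₀ > 0`, `N₀ ≥ 1` (functions of `d`, `ℓ`,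
the weight windows, `C₁`, `δ₁`) such that for every `k`, `M_h ≥ 3` with `L·M_h ≥ M₀`, `R ≥ 2L` with `R·L·M_h ≥ N₀ + 1`, torus size
`P` (`P_μ ≥ 4`), nested torus family `D` with (2.1)–(2.2), weights in the windows with `a_{i+1} = aNext ℓ a_i c_i`, EVERY `G` on
`𝔅` with `|G(y, y′)| ≦ C₁(Lʲ)⁻⁴(L^{j′})^{−(d+1)}e^{−½δ₁d_T(y,y′)}`, every fine `f` with `|f(z)| ≦ S` and every point `x`:
`|(Rf)(x)| ≦ B′₀S` for `R = 1 − G′Q′*GQ′G′` (`rProjMLT`) — `B8Ineq192MultiLevelTorus.rProjMLT_sup_bound` with its first-entry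
hypothesis discharged by `prop22_first_multiLevelTorus`. [cite: Balaban1985RegularSpaces, p.92; Balaban1985BackgroundPropagators, (3.25) p.394; Balaban1984PropagatorsII, Prop. 2.2 (2.67) p.234, Prop. 2.3 (2.87) p.238, p.224 (Ω₁ = T_η admitted)] -/
theorem rProjMLT_sup_bound_P22 (d ℓ : ℕ) (hℓ : 1 ≤ ℓ) (aminus aplus a2minus a2plus : ℝ) (ha : 0 < aminus)
    (ha2 : 0 < a2minus) {C₁ δ₁ : ℝ} (hC₁ : 0 < C₁) (hδ₁ : 0 < δ₁) :
    ∃ B₀' M₀ : ℝ, ∃ N₀ : ℕ, 0 < B₀' ∧ 0 < M₀ ∧ 0 < N₀ ∧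
      ∀ (k Mh R : ℕ), 3 ≤ Mh → M₀ ≤ ((ℓ : ℝ) + 1) * Mh → 2 * (ℓ + 1) ≤ R → N₀ + 1 ≤ R * ((ℓ + 1) * Mh) →
      ∀ (P : Fin (d + 1) → ℕ) (_hP : ∀ μ, 1 ≤ P μ) (_hP4 : ∀ μ, 4 ≤ P μ) (D : TDomains d ℓ Mh k P R) (a c : ℕ → ℝ),
        (∀ i, 1 ≤ i → aminus ≤ a i ∧ a i ≤ aplus) → (∀ i, 1 ≤ i → a2minus ≤ c i ∧ c i ≤ a2plus) →
        (∀ i, 1 ≤ i → a (i + 1) = aNext ℓ (a i) (c i)) →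
        ∀ G : Module.End ℝ (↥(bset D.toDomains) → ℝ),
          (∀ y y' : ↥(bset D.toDomains), |mat G y y' / W D.toDomains y'| ≤
            C₁ * (geomT D).len y ^ (-(4 : ℝ)) * (geomT D).len y' ^ (-((d + 1 : ℕ) : ℝ)) *
              Real.exp (-(δ₁ / 2 * (geomT D).dist y y'))) →
          ∀ (f : ↥(boxDom (N0 ℓ Mh k P)) → ℝ) (S : ℝ), 0 ≤ S → (∀ z, |f z| ≤ S) →
            ∀ x : ↥(boxDom (N0 ℓ Mh k P)), |rProjMLT D a G f x| ≤ B₀' * S := by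
  obtain ⟨δ₀, C, M₀, N₀, hδ₀, hC, hM₀, hN₀, h1⟩ := prop22_first_multiLevelTorus d ℓ hℓ aminus aplus a2minus a2plus ha ha2
  obtain ⟨B₀', N₁, hB, hN₁, hR⟩ := rProjMLT_sup_bound d ℓ hC hδ₀ hC₁ hδ₁
  refine ⟨B₀', M₀, max N₀ N₁, hB, hM₀, lt_of_lt_of_le hN₀ (le_max_left _ _), ?_⟩
  intro k Mh R hMh hM hRL hRM P hP hP4 D a c haw hcw hac G hG f S hS hf x
  have hMh1 : 1 ≤ Mh := le_trans (by norm_num) hMh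
  have hRM0 : N₀ + 1 ≤ R * ((ℓ + 1) * Mh) := le_trans (Nat.succ_le_succ (le_max_left _ _)) hRM
  have hRM1 : N₁ + 1 ≤ R * ((ℓ + 1) * Mh) := le_trans (Nat.succ_le_succ (le_max_right _ _)) hRM
  exact hR k Mh R hMh1 hRM1 P hP D a (h1 k Mh R hMh hM hRL hRM0 P hP hP4 D a c haw hcw hac) G hG f S hS hf x

/-- **THE KERNEL OF (1.91) ON THE TORUS DECAYS, WITH THE GENUINE FIRST PROP.-2.2 ENTRY** — `|(H′δ_{y′})(x)| ≦ Be^{−ρd_T(y(x),y′)}`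
and, in the (2.69) convention, `|H′(x, y′)| ≦ B(L^{j′})^{−(d+1)}e^{−ρd_T(y(x),y′)}`, for `H′ = G′²Q′*G` with `G′ = gmlT` under print's
regime of Prop. 2.2 and EVERY `G` with the (2.87)-bound (`B8Ineq192MultiLevelTorus.hKer_decay_T` with its first-entry hypothesis
discharged by `prop22_first_multiLevelTorus`). [cite: Balaban1985RegularSpaces, (1.91) p.91, p.92; Balaban1984PropagatorsII, Prop. 2.2 (2.67) p.234, Prop. 2.3 (2.87) p.238, (2.69) p.235] -/
theorem hKer_decay_T_P22 (d ℓ : ℕ) (hℓ : 1 ≤ ℓ) (aminus aplus a2minus a2plus : ℝ) (ha : 0 < aminus)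
    (ha2 : 0 < a2minus) {C₁ δ₁ : ℝ} (hC₁ : 0 < C₁) (hδ₁ : 0 < δ₁) :
    ∃ ρ B M₀ : ℝ, ∃ N₀ : ℕ, 0 < ρ ∧ 0 < B ∧ 0 < M₀ ∧ 0 < N₀ ∧
      ∀ (k Mh R : ℕ), 3 ≤ Mh → M₀ ≤ ((ℓ : ℝ) + 1) * Mh → 2 * (ℓ + 1) ≤ R → N₀ + 1 ≤ R * ((ℓ + 1) * Mh) →
      ∀ (P : Fin (d + 1) → ℕ) (_hP : ∀ μ, 1 ≤ P μ) (_hP4 : ∀ μ, 4 ≤ P μ) (D : TDomains d ℓ Mh k P R) (a c : ℕ → ℝ),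
        (∀ i, 1 ≤ i → aminus ≤ a i ∧ a i ≤ aplus) → (∀ i, 1 ≤ i → a2minus ≤ c i ∧ c i ≤ a2plus) →
        (∀ i, 1 ≤ i → a (i + 1) = aNext ℓ (a i) (c i)) →
        ∀ G : Module.End ℝ (↥(bset D.toDomains) → ℝ),
          (∀ y y' : ↥(bset D.toDomains), |mat G y y' / W D.toDomains y'| ≤
            C₁ * (geomT D).len y ^ (-(4 : ℝ)) * (geomT D).len y' ^ (-((d + 1 : ℕ) : ℝ)) *
              Real.exp (-(δ₁ / 2 * (geomT D).dist y y'))) →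
          ∀ (x : ↥(boxDom (N0 ℓ Mh k P))) (y' : ↥(bset D.toDomains)),
            |hPrimeMLT D a G (Pi.single y' 1) x| ≤ B * Real.exp (-(ρ * (geomT D).dist (blkOf D.toDomains x) y')) ∧
            |hKerT D a G x y'| ≤ B * (W D.toDomains y')⁻¹ * Real.exp (-(ρ * (geomT D).dist (blkOf D.toDomains x) y')) := by
  obtain ⟨δ₀, C, M₀, N₀, hδ₀, hC, hM₀, hN₀, h1⟩ := prop22_first_multiLevelTorus d ℓ hℓ aminus aplus a2minus a2plus ha ha2
  obtain ⟨ρ, B, N₁, hρ, hB, hN₁, hK⟩ := hKer_decay_T d ℓ hC hδ₀ hC₁ hδ₁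
  refine ⟨ρ, B, M₀, max N₀ N₁, hρ, hB, hM₀, lt_of_lt_of_le hN₀ (le_max_left _ _), ?_⟩
  intro k Mh R hMh hM hRL hRM P hP hP4 D a c haw hcw hac G hG x y'
  have hMh1 : 1 ≤ Mh := le_trans (by norm_num) hMh
  have hRM0 : N₀ + 1 ≤ R * ((ℓ + 1) * Mh) := le_trans (Nat.succ_le_succ (le_max_left _ _)) hRM
  have hRM1 : N₁ + 1 ≤ R * ((ℓ + 1) * Mh) := le_trans (Nat.succ_le_succ (le_max_right _ _)) hRM
  exact hK k Mh R hMh1 hRM1 P hP D a (h1 k Mh R hMh hM hRL hRM0 P hP hP4 D a c haw hcw hac) G hG x y'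

/-- **(1.92) AND THE p. 93 Δ-ENTRY AT U₀ = 1 ON THE `k`-LEVEL TORUS FAMILY WITH THE GENUINE PROP.-2.2 TORUS ENTRIES 1, 2, 6** —
«|(H′X)(x)|, |(∇H′X)(x)| ≦ B′₀[1, (Lʲη)⁻¹]|X| for x ∈ Ω_j» and the Δ-entry consumed on p. 93, for `H′ = G′²Q′*G` with the genuine
torus `G′ = gmlT`, `∇_μ = dT N₀ μ` (p21's periodic forward difference) and `−Δ_T = perLapT N₀`; only the inverse `(Q′G′²Q′*)⁻¹`
still enters by its printed (2.87)-bound: for every `C₁, δ₁ > 0` there are `B′₀, M₀ > 0`, `N₀ ≥ 1` (functions of `d`, `ℓ`, the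
weight windows, `C₁`, `δ₁`) such that for every `k`, `M_h ≥ 3` with `L·M_h ≥ M₀`, `R ≥ 2L` with `R·L·M_h ≥ N₀ + 1`, torus size `P`
(`P_μ ≥ 4`), nested torus family `D` with (2.1)–(2.2), weights in the windows with `a_{i+1} = aNext ℓ a_i c_i`, EVERY `G` on `𝔅`
with `|G(y, y′)| ≦ C₁(Lʲ)⁻⁴(L^{j′})^{−(d+1)}e^{−½δ₁d_T(y,y′)}`, every `X : 𝔅 → ℝ` with `|X(y′)| ≦ S` and every point `x` at its
level `j = D.lev x`: `|(H′X)(x)| ≦ B′₀S`, `|(∇_μH′X)(x)| ≦ B′₀(Lʲ)⁻¹S` (every axis), `|((−Δ_T)H′X)(x)| ≦ B′₀(Lʲ)⁻²S` —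
`B8Ineq192MultiLevelTorus.ineq192_multiLevelTorus` with its three Prop.-2.2 hypotheses discharged BY NAME by p21's
`prop22_first_multiLevelTorus`, `prop22_second_multiLevelTorus`, `prop22_sixth_multiLevelTorus` at the smallest rate and the
largest constant/thresholds (the merge of `B6Prop22AllMultiLevelBox.prop22_entries126_multiLevelBox`, on the torus).
[cite: Balaban1985RegularSpaces, (1.91)–(1.92) pp.91–92, p.93 l.1–4; Balaban1984PropagatorsII, Prop. 2.2 (2.67) p.234 (first, second, sixth entries), Prop. 2.3 (2.87) p.238, p.224 (Ω₁ = T_η admitted)] -/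
theorem ineq192_multiLevelTorus_P22 (d ℓ : ℕ) (hℓ : 1 ≤ ℓ) (aminus aplus a2minus a2plus : ℝ) (ha : 0 < aminus)
    (ha2 : 0 < a2minus) {C₁ δ₁ : ℝ} (hC₁ : 0 < C₁) (hδ₁ : 0 < δ₁) :
    ∃ B₀' M₀ : ℝ, ∃ N₀ : ℕ, 0 < B₀' ∧ 0 < M₀ ∧ 0 < N₀ ∧
      ∀ (k Mh R : ℕ), 3 ≤ Mh → M₀ ≤ ((ℓ : ℝ) + 1) * Mh → 2 * (ℓ + 1) ≤ R → N₀ + 1 ≤ R * ((ℓ + 1) * Mh) →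
      ∀ (P : Fin (d + 1) → ℕ) (_hP : ∀ μ, 1 ≤ P μ) (_hP4 : ∀ μ, 4 ≤ P μ) (D : TDomains d ℓ Mh k P R) (a c : ℕ → ℝ),
        (∀ i, 1 ≤ i → aminus ≤ a i ∧ a i ≤ aplus) → (∀ i, 1 ≤ i → a2minus ≤ c i ∧ c i ≤ a2plus) →
        (∀ i, 1 ≤ i → a (i + 1) = aNext ℓ (a i) (c i)) →
        ∀ G : Module.End ℝ (↥(bset D.toDomains) → ℝ),
          (∀ y y' : ↥(bset D.toDomains), |mat G y y' / W D.toDomains y'| ≤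
            C₁ * (geomT D).len y ^ (-(4 : ℝ)) * (geomT D).len y' ^ (-((d + 1 : ℕ) : ℝ)) *
              Real.exp (-(δ₁ / 2 * (geomT D).dist y y'))) →
          ∀ (X : ↥(bset D.toDomains) → ℝ) (S : ℝ), 0 ≤ S → (∀ y', |X y'| ≤ S) →
            ∀ x : ↥(boxDom (N0 ℓ Mh k P)),
              |hPrimeMLT D a G X x| ≤ B₀' * S ∧
              (∀ μ : Fin (d + 1), |(dT (N0 ℓ Mh k P) μ *ᵥ hPrimeMLT D a G X) x| ≤
                B₀' * (((ℓ : ℝ) + 1) ^ D.lev x.1)⁻¹ * S) ∧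
              |(perLapT (N0 ℓ Mh k P) *ᵥ hPrimeMLT D a G X) x| ≤
                B₀' * ((((ℓ : ℝ) + 1) ^ D.lev x.1) ^ 2)⁻¹ * S := by
  obtain ⟨δa, Ca, Ma, Na, hδa, hCa, hMa, hNa, h1⟩ := prop22_first_multiLevelTorus d ℓ hℓ aminus aplus a2minus a2plus ha ha2
  obtain ⟨δb, Cb, Mb, Nb, hδb, hCb, hMb, hNb, h2⟩ := prop22_second_multiLevelTorus d ℓ hℓ aminus aplus a2minus a2plus ha ha2
  obtain ⟨δc, Cc, Mc, Nc, hδc, hCc, hMc, hNc, h6⟩ := prop22_sixth_multiLevelTorus d ℓ hℓ aminus aplus a2minus a2plus ha ha2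
  have hδ₀ : 0 < min δa (min δb δc) := lt_min hδa (lt_min hδb hδc)
  have hC : 0 < max Ca (max Cb Cc) := lt_max_of_lt_left hCa
  obtain ⟨B₀', N₁, hB, hN₁, hmain⟩ := ineq192_multiLevelTorus d ℓ hC hδ₀ hC₁ hδ₁
  refine ⟨B₀', max Ma (max Mb Mc), max (max Na (max Nb Nc)) N₁, hB, lt_max_of_lt_left hMa,
    lt_max_of_lt_right hN₁, ?_⟩
  intro k Mh R hMh hM hRL hRM P hP hP4 D a c haw hcw hac G hG X S hS hX x
  have hMh1 : 1 ≤ Mh := le_trans (by norm_num) hMh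
  have hdnn : ∀ y y' : (geomT D).Site, 0 ≤ (geomT D).dist y y' := (triangle_refl_nonneg_T D hMh1 hP).2.2
  have hMa' : Ma ≤ ((ℓ : ℝ) + 1) * Mh := (le_max_left _ _).trans hM
  have hMb' : Mb ≤ ((ℓ : ℝ) + 1) * Mh := ((le_max_left _ _).trans (le_max_right _ _)).trans hM
  have hMc' : Mc ≤ ((ℓ : ℝ) + 1) * Mh := ((le_max_right _ _).trans (le_max_right _ _)).trans hM
  have hNabc : max Na (max Nb Nc) ≤ max (max Na (max Nb Nc)) N₁ := le_max_left _ _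
  have hNa' : Na + 1 ≤ R * ((ℓ + 1) * Mh) :=
    le_trans (Nat.succ_le_succ ((le_max_left Na (max Nb Nc)).trans hNabc)) hRM
  have hNb' : Nb + 1 ≤ R * ((ℓ + 1) * Mh) :=
    le_trans (Nat.succ_le_succ (((le_max_left Nb Nc).trans (le_max_right Na (max Nb Nc))).trans hNabc)) hRM
  have hNc' : Nc + 1 ≤ R * ((ℓ + 1) * Mh) :=
    le_trans (Nat.succ_le_succ (((le_max_right Nb Nc).trans (le_max_right Na (max Nb Nc))).trans hNabc)) hRM
  have hN1' : N₁ + 1 ≤ R * ((ℓ + 1) * Mh) :=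
    le_trans (Nat.succ_le_succ (le_max_right (max Na (max Nb Nc)) N₁)) hRM
  -- the weakening of a rate/constant to the common ones
  have hweak : ∀ (δ C' : ℝ), min δa (min δb δc) ≤ δ → 0 ≤ C' → C' ≤ max Ca (max Cb Cc) →
      ∀ (p : ℝ), 0 ≤ p → ∀ y y' : (geomT D).Site,
        C' * p * Real.exp (-(δ / 2 * (geomT D).dist y y'))
          ≤ max Ca (max Cb Cc) * p * Real.exp (-(min δa (min δb δc) / 2 * (geomT D).dist y y')) := by
    intro δ C' hδ hC0 hCle p hp y y'
    have he : Real.exp (-(δ / 2 * (geomT D).dist y y')) ≤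
        Real.exp (-(min δa (min δb δc) / 2 * (geomT D).dist y y')) := by
      rw [Real.exp_le_exp, neg_le_neg_iff]
      exact mul_le_mul_of_nonneg_right (by linarith) (hdnn y y')
    exact mul_le_mul (mul_le_mul_of_nonneg_right hCle hp) he (Real.exp_pos _).le (by positivity)
  have hTG := hasMajorant_mono (g := geomT D) (blkOf D.toDomains)
    (h1 k Mh R hMh hMa' hRL hNa' P hP hP4 D a c haw hcw hac)
    (fun y y' => hweak δa Ca (min_le_left _ _) hCa.le (le_max_left _ _) _ (by positivity) y y')
  have hTD : ∀ μ : Fin (d + 1), HasMajorant (g := geomT D) (blkOf D.toDomains)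
      (Matrix.toLin' (dT (N0 ℓ Mh k P) μ * gmlT (N0 ℓ Mh k P) ℓ k D.lev a))
      (fun y y' => max Ca (max Cb Cc) * ((ℓ : ℝ) + 1) ^ y.1.1 *
        Real.exp (-(min δa (min δb δc) / 2 * (geomT D).dist y y'))) := fun μ =>
    hasMajorant_mono (g := geomT D) (blkOf D.toDomains) (h2 k Mh R hMh hMb' hRL hNb' P hP hP4 D a c haw hcw hac μ)
      (fun y y' => hweak δb Cb ((min_le_right _ _).trans (min_le_left _ _)) hCb.le
        ((le_max_left _ _).trans (le_max_right _ _)) _ (by positivity) y y')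
  have hTL : HasMajorant (g := geomT D) (blkOf D.toDomains)
      (Matrix.toLin' (perLapT (N0 ℓ Mh k P) * gmlT (N0 ℓ Mh k P) ℓ k D.lev a))
      (fun y y' => max Ca (max Cb Cc) * Real.exp (-(min δa (min δb δc) / 2 * (geomT D).dist y y'))) :=
    hasMajorant_mono (g := geomT D) (blkOf D.toDomains) (h6 k Mh R hMh hMc' hRL hNc' P hP hP4 D a c haw hcw hac)
      (fun y y' => by
        have h := hweak δc Cc ((min_le_right _ _).trans (min_le_right _ _)) hCc.le
          ((le_max_right _ _).trans (le_max_right _ _)) 1 zero_le_one y y'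
        simpa only [mul_one] using h)
  exact hmain k Mh R hMh1 hN1' P hP D a (fun μ => dT (N0 ℓ Mh k P) μ) (perLapT (N0 ℓ Mh k P)) hTG hTD hTL G hG X S hS hX x

end

end Literature.MathematicalPhysics.QuantumFieldTheory.Balaban1983to89.B8Ineq192MultiLevelTorusP22
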